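/-
Copyright (c) 2026 the pub-hodgecm-mathlib formalisation cell (harness21).  Prover seat hodgecm-mathlib-K2Liu-p02 (g3), Track B «K2-LIT» ∕
hLiu418 #184♮, unit U6 «FIRST TERM AT THE TOP POLE», socket #42R `sig_K2LiuEisensteinResidueIsThetaIntegral` (steward lineage K2Liu-p02):
organ O42.3e «CONTINUITY» — `K`-finite Siegel–Weil sections are CONTINUOUS on `H(𝔸)`, and so are their standard families.  2026-09-04.
-/
import Literature.NumberTheory.K2Lit.SiegelWeilSectionLine                                   -- ★ p856173 (O42.3a): `swSection`, `isSiegelDeltaSection_swSection`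
import Literature.NumberTheory.K2Lit.SiegelStandardExtension                                  -- ★ p856298 (O42.3d): `stdExtension`, `IwasawaDatum.pPart`
import Literature.NumberTheory.GelbartRogawski1991.DoubledWeilRepresentationFiniteHalf        -- ★ `continuous_detDelta`
import Summits.HodgeConjecture.HodgeConjecture.Theorems.K2LiuIwasawaHeightContinuous          -- ★ p856591 (#31c): the Iwasawa height is continuous
import Summits.HodgeConjecture.HodgeConjecture.Theorems.K2LiuSiegelDoubledParabolicReduction   -- ★ `isClosed_siegelDelta`
import Mathlib.Topology.Algebra.Module.FiniteDimension
import Mathlib.Topology.Maps.Proper.Basic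
import HarnessLib

/-!
# K2_Liu road (hLiu418 = stmt-HodgeConjecture-24832), unit U6 «FIRST TERM», socket #42R: organ O42.3e —
# `K`-finite Siegel–Weil sections are continuous; standard extensions of continuous sections are continuous

Cell `pub/hodgecm-mathlib` (D-0151), Track B; socket #42R `sig_K2LiuEisensteinResidueIsThetaIntegral` (U6 ED. 5–7 :363; steward lineage
K2Liu-p02; SPEC `K2/K2Liu-p02/g2/SPEC-42R-RoadA-Carriers…md` §1∕§3, glue ★ p856790 `K2LiuEisensteinResidueOfGenerators`).

WHY.  Every analytic socket of the road quantifies over section families that are CONTINUOUS in `h ∈ H(𝔸)` (★ socket #9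
`siegelEisensteinDoubledSummable` needs it for absolute convergence, the glue ★ `residueIsThetaLift_of_generators` inherits the binder
`(hgc : ∀ j s, Continuous (g j s))`, tier-0 s23 and U5d's #33s ask for «a continuous `𝒦`-finite Siegel section»).  The GENERATORS of the
road are the Siegel–Weil families `stdExtension 𝒦 s₀ f_Φ`, `f_Φ(h) = (ω(r_F(δ)·sD h)Φ)(0)` (★ `swSection`), for a `χ`-normalised doubled Weil
representation `sD` (★ `IsDoubledWeilRep χ sD`).  In print the continuity of `f_Φ` is a remark ([Weil1964, n° 39]: `Mp(X)_A` acts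
continuously on `𝒮(X_A)`); in the tree `sD` is continuous only for the COEFFICIENT topology of `Mp(𝕎^𝔻)ᶜᵒⁿᵗ` (★ `AdelicMetaplecticGroup` §4:
initial for `p ↦ π(p)w` and `p ↦ (ω(p)Φ)(x)`), in which the fixed operator `ω(r_F(δ))` — an adelic partial Fourier transform — is NOT known
to act continuously, so `h ↦ (ω(r_F(δ))(ω(sD h)Φ))(0)` is not formally a composite of continuous maps.  THIS FILE closes the gap for the
sections the road actually uses, the `K`-FINITE ones, by finite-dimensionality:

* §1 `continuous_of_continuous_mul_decomposition` — TOPOLOGY: `G` a topological group, `P ≤ G` CLOSED, `K ≤ G` COMPACT, `G = P·K`; a map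
  `f : G → X` with `(p, k) ↦ f(p k)` continuous on `P × K` is continuous (the multiplication `P × K → G` is a closed — hence quotient —
  map: it is `fst ∘ (g, k) ↦ (g k, k) ∘ (P × K ↪ G × K)`, a closed embedding followed by a homeomorphism followed by the projection along
  the compact factor, Mathlib `isClosedMap_fst_of_compactSpace`, `IsClosedMap.isQuotientMap`);
* §2 `continuous_siegelDeltaCharacter_subtype` — the inducing character `p ↦ χ(det_Δ p)·|det_Δ p|^{s + n/2}` is continuous on `P_Δ(𝔸)`
  (`det_Δ` is continuous into the IDELES on `P_Δ(𝔸)` — both `det_Δ p` and `(det_Δ p)⁻¹ = det_Δ(p⁻¹)` are polynomial — then ★ `map_continuous χ`,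
  ★ `continuous_ideleNorm_holds`, `Continuous.cpow` on the positive reals; the `H(𝔸)`-version of ★ `continuousOn_chiDet_modDelta`);
* §3 `continuous_opD_mul_of_finiteDimensional` — for `sD` continuous (coefficient topology), `K ≤ H(𝔸)` and `Φ` with
  `V := span{ω(sD k)Φ : k ∈ K}` FINITE-DIMENSIONAL: `k ↦ (ω(q₀·sD k)Φ)(x₀)` is continuous on `K` for EVERY fixed `q₀ ∈ Mp(𝕎^𝔻)ᶜᵒⁿᵗ`, `x₀`
  (the orbit `k ↦ ω(sD k)Φ ∈ V` is continuous for the pointwise topology, which on the finite-dimensional `V` is THE Hausdorff vector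
  topology, and `Ψ ↦ (ω(q₀)Ψ)(x₀)` is a linear functional on `V`, Mathlib `LinearMap.continuous_of_finiteDimensional`);
* §4 **`continuous_swSection`** — for `IsDoubledWeilRep χ sD`, an Iwasawa datum `𝒦` and a `K`-finite `Φ` (the hypothesis of ★
  `isKFinite_swSection`, p856329), `f_Φ = swSection sD Φ` is CONTINUOUS on `H(𝔸)`: `f_Φ(p k) = χ_{(1−n)/2}(p)·f_Φ(k)` (★
  `isSiegelDeltaSection_swSection`) is continuous on `P_Δ(𝔸) × K` by §2 and §3 (`q₀ = r_F(δ)`, `x₀ = 0`), `P_Δ(𝔸)` is closed (★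
  `isClosed_siegelDelta`), `K` compact, `H(𝔸) = P_Δ(𝔸)·K` (★ `IwasawaDatum.iwasawa`), so §1 applies;
* §5 `continuous_stdExtension` — for ANY Iwasawa datum and any continuous `φ`, `h ↦ f_s(h) = |det_Δ p_h|^{s−s₀}·φ(h)` is continuous (★ #31c
  `iwasawaHeightContinuous`: the Iwasawa height is positive and continuous; `Continuous.cpow`), and **`continuous_swFamily`** — the
  Siegel–Weil STANDARD FAMILY `stdExtension 𝒦 s₀ (swSection sD Φ) s` of a `K`-finite `Φ` is continuous for every `s`: with ★
  `isStandardSectionFamily_stdExtension` + ★ `isKFinite_swSection` + ★ `IwasawaDatum.modDelta_eq_one_of_mem` these families ARE members of the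
  glue's generator class (`hg`, `hgc` of ★ `residueIsThetaLift_of_generators`).

Mathlib + ★ only; no `sorry`, no definition, no instance, no notation.  HONEST LABEL: HC_CM is proved only modulo the 7 printed citations
(2 remaining named inputs: hLiu418 = stmt-HodgeConjecture-24832, h413 = stmt-HodgeConjecture-24833) until rung 0 closes; this file is a
`--supports stmt-HodgeConjecture-24832` helper of the #42R road (it retires nothing by itself).

References: [Weil1964] A. Weil, Acta Math. 111 (1964), Chap. III n° 39 p. 189 (continuity of the adelic Weil representation); [KudlaRallis1994]
S. Kudla, S. Rallis, Ann. of Math. 140 (1994) §1 (`K`-finite Siegel–Weil sections, standard sections); [HarrisKudlaSweet1996] §1 (1.15)–(1.17);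
[Tan1999] V. Tan, Canad. J. Math. 51 (1999) §1; [MoeglinWaldspurger1995] I.2.2 (Iwasawa decomposition `G(𝔸) = P(𝔸)K`).
-/

set_option autoImplicit false
set_option linter.dupNamespace false
-- the doubled metaplectic carrier `Mp(𝕎^𝔻)ᶜᵒⁿᵗ` elaborates slowly (cf. ★ `SiegelWeilSectionLine`, ★ `K2LiuSiegelWeilSectionKFinite`): term-mode chains
set_option Elab.async false

noncomputable section

open NumberField IsDedekindDomain Topology
open scoped Matrix

namespace Summit.HodgeConjecture.HodgeConjecture.Cruxes.HLiu418.K2LiuSiegelWeilSectionContinuous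

open Literature.NumberTheory.Automorphic Literature.NumberTheory.Automorphic.IdeleClassGroup
open Literature.NumberTheory.GaloisRepresentations
open Literature.NumberTheory.GelbartRogawski1991 Literature.NumberTheory.GelbartRogawski1991.GRConstruction
open Literature.NumberTheory.Weil1964
open Literature.NumberTheory.K2Lit.SiegelDoubled
open Summit.HodgeConjecture.HodgeConjecture.Cruxes.HLiu418.K2LiuIwasawaHeightContinuous (iwasawaHeightContinuous)
open Summit.HodgeConjecture.HodgeConjecture.Cruxes.HLiu418.K2LiuSiegelDoubledParabolicReduction (isClosed_siegelDelta)

/-! ## §1 Topology: a map continuous along a closed × compact multiplication `P × K → G = P·K` is continuous -/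

/-- **Continuity through the Iwasawa multiplication.**  In a topological group `G` let `P` be a CLOSED subgroup and `K` a COMPACT one with
`G = P·K`.  If `(p, k) ↦ f(p·k)` is continuous on `P × K` then `f` is continuous on `G`: the multiplication `m : P × K → G` is continuous,
surjective and CLOSED (`m = fst ∘ θ ∘ ι` with `ι : P × K ↪ G × K` a closed embedding, `θ(g, k) = (g k, k)` a homeomorphism of `G × K`, and
`fst : G × K → G` closed because `K` is compact), hence a quotient map. [cite: MoeglinWaldspurger1995, I.2.2] -/
theorem continuous_of_continuous_mul_decomposition {G : Type*} [TopologicalSpace G] [Group G] [IsTopologicalGroup G]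
    (P K : Subgroup G) (hP : IsClosed (P : Set G)) (hK : IsCompact (K : Set G))
    (hPK : ∀ g : G, ∃ p k : G, p ∈ P ∧ k ∈ K ∧ g = p * k)
    {X : Type*} [TopologicalSpace X] {f : G → X}
    (hf : Continuous fun x : P × K => f ((x.1 : G) * (x.2 : G))) : Continuous f := by
  haveI : CompactSpace K := isCompact_iff_compactSpace.1 hK
  -- the multiplication map
  let m : P × K → G := fun x => (x.1 : G) * (x.2 : G)
  have hmc : Continuous m :=
    (continuous_subtype_val.comp continuous_fst).mul (continuous_subtype_val.comp continuous_snd)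
  have hms : Function.Surjective m := fun g => by
    obtain ⟨p, k, hp, hk, rfl⟩ := hPK g
    exact ⟨(⟨p, hp⟩, ⟨k, hk⟩), rfl⟩
  -- the shear homeomorphism `(g, k) ↦ (g k, k)` of `G × K`
  let θ : G × K ≃ₜ G × K :=
    { toFun := fun x => (x.1 * (x.2 : G), x.2)
      invFun := fun x => (x.1 * (x.2 : G)⁻¹, x.2)
      left_inv := fun x => by simp
      right_inv := fun x => by simp
      continuous_toFun := (continuous_fst.mul (continuous_subtype_val.comp continuous_snd)).prodMk continuous_snd
      continuous_invFun := (continuous_fst.mul (continuous_subtype_val.comp continuous_snd).inv).prodMk continuous_snd }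
  -- the closed embedding `P × K ↪ G × K`
  have hι : IsClosedEmbedding (Prod.map (Subtype.val : P → G) (Homeomorph.refl K)) :=
    hP.isClosedEmbedding_subtypeVal.prodMap (Homeomorph.refl K).isClosedEmbedding
  have hfst : IsClosedMap (Prod.fst : G × K → G) := isClosedMap_fst_of_compactSpace
  have hfac : m = Prod.fst ∘ θ ∘ Prod.map (Subtype.val : P → G) (Homeomorph.refl K) := by
    funext x
    rfl
  have hclosed : IsClosedMap m := by
    rw [hfac]
    exact hfst.comp (θ.isClosedMap.comp hι.isClosedMap)
  have hq : IsQuotientMap m := hclosed.isQuotientMap hmc hms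
  exact hq.continuous_iff.2 hf

variable (L : Type) [Field L] [NumberField L] [IsCMField L]
variable {N M n : ℕ} (e : Fin N × Fin M ≃ Fin n)
  (dV : Fin N → L) (hdV : ∀ i, IsCMField.complexConj L (dV i) = dV i) (hdV0 : ∀ i, dV i ≠ 0)
  (dW : Fin M → L) (hdW : ∀ i, IsCMField.complexConj L (dW i) = dW i) (hdW0 : ∀ i, dW i ≠ 0)

/-! ## §2 The inducing character is continuous on `P_Δ(𝔸)` -/

/-- **`det_Δ` is continuous into the IDELES on `P_Δ(𝔸)`**: the unit `det_Δ p` (★ `isUnit_detDelta_of_isSiegelDelta`) depends continuously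
on `p ∈ P_Δ(𝔸)` for the idele topology — its value `det_Δ p` and its inverse `det_Δ(p⁻¹)` (★ `detDelta_mul_inv`) are both continuous
(★ `continuous_detDelta`; inversion is continuous on `H(𝔸)`). [cite: Kudla1994, §2, Thm. 3.1] -/
theorem continuous_unit_detDelta :
    Continuous fun p : siegelDelta L e dV hdV dW hdW =>
      (isUnit_detDelta_of_isSiegelDelta L e dV hdV dW hdW (p : HA L e dV hdV dW hdW) p.2).unit := by
  have hp : ∀ p : siegelDelta L e dV hdV dW hdW, IsSiegelDelta L e dV hdV dW hdW (p : HA L e dV hdV dW hdW) := fun p => p.2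
  refine Units.continuous_iff.2 ⟨?_, ?_⟩
  · -- the value `det_Δ p`
    exact ((continuous_detDelta L e dV hdV dW hdW).comp continuous_subtype_val).congr fun p => (IsUnit.unit_spec _).symm
  · -- the inverse `(det_Δ p)⁻¹ = det_Δ(p⁻¹)`
    refine ((continuous_detDelta L e dV hdV dW hdW).comp (continuous_subtype_val.inv)).congr fun p => ?_
    have hu := isUnit_detDelta_of_isSiegelDelta L e dV hdV dW hdW (p : HA L e dV hdV dW hdW) (hp p)
    have e1 : ((hu.unit⁻¹ : ideleGroup L) : AdeleRing (𝓞 L) L) * detDelta L e dV hdV dW hdW (p : HA L e dV hdV dW hdW) = 1 :=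
      hu.unit.inv_mul
    have e2 : detDelta L e dV hdV dW hdW (p : HA L e dV hdV dW hdW) * detDelta L e dV hdV dW hdW ((p : HA L e dV hdV dW hdW)⁻¹) = 1 :=
      detDelta_mul_inv L e dV hdV dW hdW (hp p)
    show detDelta L e dV hdV dW hdW ((p : HA L e dV hdV dW hdW)⁻¹) = ((hu.unit⁻¹ : ideleGroup L) : AdeleRing (𝓞 L) L)
    calc detDelta L e dV hdV dW hdW ((p : HA L e dV hdV dW hdW)⁻¹)
        = (((hu.unit⁻¹ : ideleGroup L) : AdeleRing (𝓞 L) L) * detDelta L e dV hdV dW hdW (p : HA L e dV hdV dW hdW)) *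
            detDelta L e dV hdV dW hdW ((p : HA L e dV hdV dW hdW)⁻¹) := by rw [e1, one_mul]
      _ = ((hu.unit⁻¹ : ideleGroup L) : AdeleRing (𝓞 L) L) := by rw [mul_assoc, e2, mul_one]

/-- **The inducing character `p ↦ χ(det_Δ p)·|det_Δ p|^{s + n/2}` (★ `siegelDeltaCharacter χ s`) is continuous on `P_Δ(𝔸)`**
(Hecke characters and the idele norm are continuous on the ideles; `z ↦ z^{2s+n}` is continuous on the positive reals).
[cite: Tan1999, §1] [cite: KudlaRallis1994, §1] -/
theorem continuous_siegelDeltaCharacter_subtype (χ : HeckeCharacter L) (s : ℂ) :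
    Continuous fun p : siegelDelta L e dV hdV dW hdW => siegelDeltaCharacter L e dV hdV dW hdW χ s (p : HA L e dV hdV dW hdW) := by
  have hUc := continuous_unit_detDelta L e dV hdV dW hdW
  -- `chiDet` and `modDelta` through the unit
  have hchi : ∀ p : siegelDelta L e dV hdV dW hdW, chiDet L e dV hdV dW hdW χ (p : HA L e dV hdV dW hdW) =
      χ (isUnit_detDelta_of_isSiegelDelta L e dV hdV dW hdW (p : HA L e dV hdV dW hdW) p.2).unit := fun p => by
    unfold chiDet
    rw [dif_pos (isUnit_detDelta_of_isSiegelDelta L e dV hdV dW hdW (p : HA L e dV hdV dW hdW) p.2)]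
  have hmod : ∀ p : siegelDelta L e dV hdV dW hdW, modDelta L e dV hdV dW hdW (p : HA L e dV hdV dW hdW) =
      Real.sqrt (ideleNorm (isUnit_detDelta_of_isSiegelDelta L e dV hdV dW hdW (p : HA L e dV hdV dW hdW) p.2).unit) := fun p => by
    unfold modDelta
    rw [dif_pos (isUnit_detDelta_of_isSiegelDelta L e dV hdV dW hdW (p : HA L e dV hdV dW hdW) p.2)]
  have hnorm : Continuous fun x : ideleGroup L => ideleNorm x := by
    have h := NNReal.continuous_coe.comp (continuous_ideleNorm_holds L)
    refine h.congr fun x => ?_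
    exact coe_ideleNorm L x
  have h1 : Continuous fun p : siegelDelta L e dV hdV dW hdW =>
      ((chiDet L e dV hdV dW hdW χ (p : HA L e dV hdV dW hdW) : ℂˣ) : ℂ) := by
    have h := (Units.continuous_val.comp (map_continuous χ)).comp hUc
    exact h.congr fun p => by simp only [Function.comp_apply, hchi p]
  have h2 : Continuous fun p : siegelDelta L e dV hdV dW hdW => ((modDelta L e dV hdV dW hdW (p : HA L e dV hdV dW hdW) : ℝ) : ℂ) := by
    have h := Complex.continuous_ofReal.comp ((Real.continuous_sqrt.comp hnorm).comp hUc)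
    exact h.congr fun p => by simp only [Function.comp_apply, hmod p]
  have h3 : Continuous fun p : siegelDelta L e dV hdV dW hdW =>
      ((modDelta L e dV hdV dW hdW (p : HA L e dV hdV dW hdW) : ℝ) : ℂ) ^ (2 * s + (n : ℂ)) :=
    h2.cpow continuous_const fun p => Complex.ofReal_mem_slitPlane.2 (modDelta_pos L e dV hdV dW hdW _)
  unfold siegelDeltaCharacter
  exact h1.mul h3

/-! ## §3 Finite-dimensionality: coefficient-continuous orbits inside a finite-dimensional span are continuous through any fixed linear operator -/

/-- **Generic finite-dimensionality step.**  `W` a space of functions `X → ℂ` (pointwise topology), `orb : T → W` an orbit map that is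
continuous COEFFICIENT-WISE (`t ↦ (orb t)(x)` continuous for every `x`) with finite-dimensional span, `A : W →ₗ W` ANY linear operator:
then `t ↦ (A (orb t))(x₀)` is continuous — the orbit is continuous into the span `V` (a subtype of the product space), and the linear
functional `Ψ ↦ (A Ψ)(x₀)` is continuous on the finite-dimensional Hausdorff `V` (Mathlib `LinearMap.continuous_of_finiteDimensional`).
[folklore] [cite: Weil1964, Chap. III n° 39 p. 189] -/
theorem continuous_apply_linearMap_of_finiteDimensional_span {X T : Type*} [TopologicalSpace T]
    (W : Submodule ℂ (X → ℂ)) (orb : T → W) (horb : ∀ x : X, Continuous fun t => (orb t : X → ℂ) x)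
    (hfin : FiniteDimensional ℂ (Submodule.span ℂ (Set.range orb))) (A : W →ₗ[ℂ] W) (x₀ : X) :
    Continuous fun t => (A (orb t) : X → ℂ) x₀ := by
  haveI : FiniteDimensional ℂ (Submodule.span ℂ (Set.range orb)) := hfin
  -- the orbit into the span, continuous for the pointwise topology
  have hγ : Continuous fun t => (⟨orb t, Submodule.subset_span ⟨t, rfl⟩⟩ : Submodule.span ℂ (Set.range orb)) := by
    refine Continuous.subtype_mk ?_ _
    exact continuous_induced_rng.2 (continuous_pi horb)
  -- the linear functional `Ψ ↦ (A Ψ)(x₀)` on the span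
  let ℓ : Submodule.span ℂ (Set.range orb) →ₗ[ℂ] ℂ := (LinearMap.proj x₀ ∘ₗ W.subtype ∘ₗ A) ∘ₗ (Submodule.span ℂ (Set.range orb)).subtype
  have hℓ : Continuous ℓ :=
    LinearMap.continuous_of_finiteDimensional (𝕜 := ℂ) (E := Submodule.span ℂ (Set.range orb)) (F' := ℂ) ℓ
  exact (hℓ.comp hγ).congr fun t => rfl

/-- **Through a fixed operator on a `K`-finite span.**  Let `sD : H(𝔸) →* Mp(𝕎^𝔻)ᶜᵒⁿᵗ` be continuous (coefficient topology), `K ≤ H(𝔸)`, and `Φ`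
with `span{ω(sD k)Φ : k ∈ K}` finite-dimensional.  Then for every FIXED `q₀ ∈ Mp(𝕎^𝔻)ᶜᵒⁿᵗ` and `x₀`, `k ↦ (ω(q₀·sD k)Φ)(x₀)` is continuous on
`K` (`ω(q₀·q) = ω(q₀)ω(q)`; ★ `adelicMpCont.continuous_omega_apply`; the generic step). [cite: Weil1964, Chap. III n° 39 p. 189]
[cite: HarrisKudlaSweet1996, §1 (1.16)] -/
theorem continuous_opD_mul_of_finiteDimensional {sD : HA L e dV hdV dW hdW →* MpD L e dV hdV dW hdW} (hc : Continuous sD)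
    (K : Subgroup (HA L e dV hdV dW hdW)) (Φ : piSchwartzBruhat (Fp L) (Fin (n + n)))
    (hΦ : FiniteDimensional ℂ (Submodule.span ℂ (Set.range fun k : K =>
      adelicMpCont.omega (Fp L) (Fin (n + n)) (gramDA L e dV hdV dW hdW) (sD (k : HA L e dV hdV dW hdW)) Φ)))
    (q₀ : MpD L e dV hdV dW hdW) (x₀ : Fin (n + n) → AdeleRing (𝓞 (Fp L)) (Fp L)) :
    Continuous fun k : K => opD L e dV hdV dW hdW (q₀ * sD (k : HA L e dV hdV dW hdW)) Φ x₀ := by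
  have h := continuous_apply_linearMap_of_finiteDimensional_span (piSchwartzBruhat (Fp L) (Fin (n + n)))
    (fun k : K => adelicMpCont.omega (Fp L) (Fin (n + n)) (gramDA L e dV hdV dW hdW) (sD (k : HA L e dV hdV dW hdW)) Φ)
    (fun x => (adelicMpCont.continuous_omega_apply (F := Fp L) (ι := Fin (n + n)) (T := gramDA L e dV hdV dW hdW) Φ x).comp
      (hc.comp continuous_subtype_val))
    hΦ (adelicMpCont.omega (Fp L) (Fin (n + n)) (gramDA L e dV hdV dW hdW) q₀) x₀
  refine h.congr fun k => ?_
  -- `ω(q₀)(ω(sD k)Φ) = ω(q₀ · sD k)Φ`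
  have hop := LinearMap.congr_fun
    ((adelicMpCont.omega (Fp L) (Fin (n + n)) (gramDA L e dV hdV dW hdW)).map_mul q₀ (sD (k : HA L e dV hdV dW hdW))) Φ
  exact (congrArg (fun T : piSchwartzBruhat (Fp L) (Fin (n + n)) => (T : (Fin (n + n) → AdeleRing (𝓞 (Fp L)) (Fp L)) → ℂ) x₀) hop).symm

/-! ## §4 `K`-finite Siegel–Weil sections are continuous -/

include hdV0 hdW0 in
/-- **`K`-FINITE SIEGEL–WEIL SECTIONS ARE CONTINUOUS.**  For a `χ`-normalised doubled Weil representation `sD` (★ `IsDoubledWeilRep χ sD`), an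
Iwasawa datum `𝒦` (★ `IwasawaDatum`: `K` compact, `H(𝔸) = P_Δ(𝔸)·K`) and `Φ ∈ 𝒮(𝔸^{n+n})` whose `K`-orbit under `ω ∘ sD` spans a
finite-dimensional space (the hypothesis of ★ `isKFinite_swSection`), the Siegel–Weil section `f_Φ = swSection sD Φ` (★ O42.3a) is continuous on
`H(𝔸)`.  Proof: `f_Φ(p k) = χ_{(1−n)/2}(p)·f_Φ(k)` (★ `isSiegelDeltaSection_swSection`) is continuous on `P_Δ(𝔸) × K` by §2 and §3 (`q₀ = r_F(δ)`,
`x₀ = 0`); `P_Δ(𝔸)` is closed (★ `isClosed_siegelDelta`); §1. [cite: KudlaRallis1994, §1] [cite: Weil1964, Chap. III n° 39 p. 189]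
[cite: HarrisKudlaSweet1996, §1 (1.15)–(1.16)] -/
theorem continuous_swSection {χ : HeckeCharacter L} {sD : HA L e dV hdV dW hdW →* MpD L e dV hdV dW hdW}
    (hsD : IsDoubledWeilRep L e dV hdV hdV0 dW hdW hdW0 χ sD) (𝒦 : IwasawaDatum L e dV hdV dW hdW)
    (Φ : piSchwartzBruhat (Fp L) (Fin (n + n)))
    (hΦ : FiniteDimensional ℂ (Submodule.span ℂ (Set.range fun k : 𝒦.K =>
      adelicMpCont.omega (Fp L) (Fin (n + n)) (gramDA L e dV hdV dW hdW) (sD (k : HA L e dV hdV dW hdW)) Φ))) :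
    Continuous (swSection L e dV hdV hdV0 dW hdW hdW0 sD Φ) := by
  refine continuous_of_continuous_mul_decomposition (siegelDelta L e dV hdV dW hdW) 𝒦.K
    (isClosed_siegelDelta L e dV hdV dW hdW) 𝒦.isCompact_K (fun h => ?_) ?_
  · obtain ⟨p, k, hp, hk, hh⟩ := 𝒦.iwasawa h
    exact ⟨p, k, hp, hk, hh⟩
  · have hsec := isSiegelDeltaSection_swSection L e dV hdV hdV0 dW hdW hdW0 hsD Φ
    have heq : (fun x : siegelDelta L e dV hdV dW hdW × 𝒦.K =>
        swSection L e dV hdV hdV0 dW hdW hdW0 sD Φ ((x.1 : HA L e dV hdV dW hdW) * (x.2 : HA L e dV hdV dW hdW))) =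
        fun x => siegelDeltaCharacter L e dV hdV dW hdW χ ((1 - (n : ℂ)) / 2) (x.1 : HA L e dV hdV dW hdW) *
          swSection L e dV hdV hdV0 dW hdW hdW0 sD Φ (x.2 : HA L e dV hdV dW hdW) :=
      funext fun x => hsec _ (show IsSiegelDelta L e dV hdV dW hdW (x.1 : HA L e dV hdV dW hdW) from x.1.2) _
    rw [heq]
    refine ((continuous_siegelDeltaCharacter_subtype L e dV hdV dW hdW χ _).comp continuous_fst).mul ?_
    exact (continuous_opD_mul_of_finiteDimensional L e dV hdV dW hdW hsD.continuous 𝒦.K Φ hΦ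
      (rDelta L e dV hdV hdV0 dW hdW hdW0) 0).comp continuous_snd

/-! ## §5 Standard extensions of continuous sections are continuous; the Siegel–Weil standard family is continuous -/

include hdV0 hdW0 in
/-- **The standard extension of a continuous function is continuous**: `h ↦ f_s(h) = (|det_Δ p_h|^{1/2})^{2(s−s₀)}·φ(h)` (★ `stdExtension 𝒦 s₀ φ s`)
is continuous for every `s` when `φ` is — the Iwasawa height `h ↦ |det_Δ p_h|^{1/2}` is positive and continuous (★ #31c
`iwasawaHeightContinuous`) and `z ↦ z^{c}` is continuous on the positive reals. [cite: Tan1999, §1] [cite: KudlaRallis1994, §1] -/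
theorem continuous_stdExtension (𝒦 : IwasawaDatum L e dV hdV dW hdW) (s₀ : ℂ) {φ : HA L e dV hdV dW hdW → ℂ} (hφ : Continuous φ)
    (s : ℂ) : Continuous (stdExtension 𝒦 s₀ φ s) := by
  have hpos := (iwasawaHeightContinuous L e dV hdV hdV0 dW hdW hdW0 𝒦).1
  have hcont := (iwasawaHeightContinuous L e dV hdV hdV0 dW hdW hdW0 𝒦).2
  show Continuous fun h => ((modDelta L e dV hdV dW hdW (𝒦.pPart h) : ℝ) : ℂ) ^ (2 * (s - s₀)) * φ h
  exact ((Complex.continuous_ofReal.comp hcont).cpow continuous_const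
    (fun h => Complex.ofReal_mem_slitPlane.2 (hpos h))).mul hφ

include hdV0 hdW0 in
/-- **THE SIEGEL–WEIL STANDARD FAMILY OF A `K`-FINITE `Φ` IS CONTINUOUS**: `h ↦ stdExtension 𝒦 s₀ (swSection sD Φ) s h` is continuous for every
`s₀, s` (§4 + `continuous_stdExtension`).  Together with ★ `isStandardSectionFamily_stdExtension`, ★ `isKFinite_swSection`, ★
`isSiegelDeltaSection_swSection` and ★ `IwasawaDatum.modDelta_eq_one_of_mem`, the Siegel–Weil family at `s₀ = (1 − n)/2` is a STANDARD family
CONTINUOUS in `h` — a member of the generator class of the glue ★ `residueIsThetaLift_of_generators` (its binders `hg`, `hgc`).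
[cite: KudlaRallis1994, §1] [cite: HarrisKudlaSweet1996, §1 (1.15)–(1.17)] [cite: Tan1999, §1] -/
theorem continuous_swFamily {χ : HeckeCharacter L} {sD : HA L e dV hdV dW hdW →* MpD L e dV hdV dW hdW}
    (hsD : IsDoubledWeilRep L e dV hdV hdV0 dW hdW hdW0 χ sD) (𝒦 : IwasawaDatum L e dV hdV dW hdW)
    (Φ : piSchwartzBruhat (Fp L) (Fin (n + n)))
    (hΦ : FiniteDimensional ℂ (Submodule.span ℂ (Set.range fun k : 𝒦.K =>
      adelicMpCont.omega (Fp L) (Fin (n + n)) (gramDA L e dV hdV dW hdW) (sD (k : HA L e dV hdV dW hdW)) Φ)))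
    (s₀ s : ℂ) : Continuous (stdExtension 𝒦 s₀ (swSection L e dV hdV hdV0 dW hdW hdW0 sD Φ) s) :=
  continuous_stdExtension L e dV hdV hdV0 dW hdW hdW0 𝒦 s₀ (continuous_swSection L e dV hdV hdV0 dW hdW hdW0 hsD 𝒦 Φ hΦ) s

end Summit.HodgeConjecture.HodgeConjecture.Cruxes.HLiu418.K2LiuSiegelWeilSectionContinuous

end
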